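import Mathlib
import HarnessLib
import Summits.ValiantsHypothesis.ValiantsHypothesis.Theses.MonotoneRestoration
import Literature.Computability.AlgebraicComplexity.ArithCircuit
import Literature.Computability.AlgebraicComplexity.ArithCircuitProofs
import Literature.Computability.AlgebraicComplexity.MonotoneStructure
import Literature.Computability.AlgebraicComplexity.PermanentIrreducible
import Literature.ModelTheory.FiniteModelTheory.CkEquiv
import Summits.ValiantsHypothesis.ValiantsHypothesis.Theorems.MonotoneRestorationMonotoneRestorationQPCosetCount
import Summits.ValiantsHypothesis.ValiantsHypothesis.Theorems.MonotoneRestorationMonotoneRestorationQPSymmetricLB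
import Summits.ValiantsHypothesis.ValiantsHypothesis.Theorems.MonotoneRestorationMonotoneRestorationQPSupportSymmetrisation
import Summits.ValiantsHypothesis.ValiantsHypothesis.Theorems.MonotoneRestorationMonotoneRestorationQPSparseRegime
import Summits.ValiantsHypothesis.ValiantsHypothesis.Theorems.MonotoneRestorationMonotoneRestorationQPBeta
import Literature.Computability.AlgebraicComplexity.SymmetricArithCircuit
import Literature.Computability.AlgebraicComplexity.DawarWilsenach2025Proofs
import Literature.GroupTheory.PermutationGroups.SmallIndexSubgroups
import Summits.ValiantsHypothesis.ValiantsHypothesis.Theorems.MonotoneRestorationQP.Negative.LoadBearing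
import Summits.ValiantsHypothesis.ValiantsHypothesis.Theorems.MonotoneRestorationMonotoneRestorationQPPermSupportCount

/-! TTRL-lite variant V19829 of stmt-ValiantsHypothesis-15886

Target `stub_gammaArithmetic`, move `lemma_proposal`: the stub's own side condition `4k ≤ n`
already gives `4^k ≤ C(n,k)` (the binomial conjunct with exponential slack).  Proof by induction
on `k` generalizing `n`, via `(m+1)·C(m,k) = C(m+1,k+1)·(k+1)` (`Nat.add_one_mul_choose_eq`):
`(k+1)·4^(k+1) = (4(k+1))·4^k ≤ (m+1)·C(m,k) = C(m+1,k+1)·(k+1)`, then cancel `k+1`.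
-/

-- `Summit.ValiantsHypothesis.ValiantsHypothesis.…` is the tree's mandated single-conjunct layout
-- (Sub = Summit), so the duplicated namespace component is intended.
set_option linter.dupNamespace false

namespace Summit.ValiantsHypothesis.ValiantsHypothesis.Theorems

open Summit.ValiantsHypothesis.ValiantsHypothesis.Theses.MonotoneRestoration
open Literature.Computability.AlgebraicComplexity

/-- **TTRL-lite variant V19829 of `stub_gammaArithmetic`**: for `4k ≤ n` one has
`4^k ≤ C(n,k)` (a weak form of `(n/k)^k ≤ C(n,k)`).  Induction on `k` generalizing `n`:
writing `n = m + 1`, `(k+1)·4^(k+1) = (4(k+1))·4^k ≤ (m+1)·C(m,k) = C(m+1,k+1)·(k+1)`. -/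
theorem stub_gammaArithmetic_var19829 :
    ∀ (n k : ℕ), 4 * k ≤ n → 4 ^ k ≤ n.choose k := by
  intro n k
  induction k generalizing n with
  | zero =>
    intro _
    simp
  | succ k ih =>
    intro hk
    obtain ⟨m, rfl⟩ : ∃ m, n = m + 1 := ⟨n - 1, by omega⟩
    have h1 : 4 ^ k ≤ m.choose k := ih m (by omega)
    have h2 : (m + 1) * m.choose k = (m + 1).choose (k + 1) * (k + 1) :=
      Nat.add_one_mul_choose_eq m k
    have h3 : 4 ^ (k + 1) * (k + 1) ≤ (m + 1).choose (k + 1) * (k + 1) := by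
      rw [← h2]
      calc 4 ^ (k + 1) * (k + 1) = (4 * (k + 1)) * 4 ^ k := by ring
        _ ≤ (m + 1) * m.choose k := Nat.mul_le_mul hk h1
    exact le_of_mul_le_mul_right h3 (Nat.succ_pos k)

end Summit.ValiantsHypothesis.ValiantsHypothesis.Theorems
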